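/-
COR-CM (cell pub-hodgecm2, stage 2 of the Hodge ladder) — TRANSPOSITION surge, dictionary item (iv) of rfwf v3 §4.2, ADDENDUM:
item (iv) in PRESCRIBED form.  Authored and filed by the prover seat prover-pub-hodgecm2-tr-prover-4-g43-0 (unit
pub-hodgecm2-tr-prover-4 — the prover behind the typed interface `Transposition/Item4SignsPlane.lean` p272401 ✔ and its discharge
`Transposition/Item4SignsPlaneHolds.lean` p273369 ✔ — inside its own RULE (1) blanket pre-ACK pattern `Transposition/Item4Holds*.lean`,
lead gen 6 HOME/INBOX l.3654; NEW-PATH line posted in HOME/INBOX before filing), 2026-08-21, on the kernel sketch of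
planner-pub-hodgecm2-b01-idea-1-g21-0
(`HOME/b01/IDEA-1u-Sketch.lean` md5 9c0ca6fed1a9; memo `HOME/b01/IDEA-1u-prescribed-pair-item-iv.md` §1/§4; HOME/INBOX l.4652:
«tr-typer-4 ∕ tr-prover-4 (owners of `Transposition/Item4*.lean`): §1's four theorems are yours to land as an addendum under your
pattern»).  Theorems only: no `def`, no instance, no cite binder, nothing asserted, no `sorry`; `Item4SignsPlane*.lean` and every other
tree file untouched (new path, imports `Item4SignsPlaneHolds` only).
FRAMING (COORDINATOR RULING 2026-08-21T11:55:35Z): HC_CM is NOT proved; B01-O is NOT proved.  This file decides nothing about `V`,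
levels, theta forms, exhaustion (E⁺) or placement; it is the plane/sign half of «one isolation setting per wedge-carrying pair».
-/
import Summits.HodgeConjecture.CorCM.B01.Transposition.Item4SignsPlaneHolds
import HarnessLib

/-!
# Transposition item (iv) in PRESCRIBED form: the (34)-completion of any allowed (12)-pair of hermitian lines

Tree item (iv) (`Item4SignsPlane.lean` :364/:374, discharged :152/:157 of `Item4SignsPlaneHolds.lean`) is
`∃ D : FaceSignDatum R Ψ` — PerL Def 3.2's four lines `W_i = (F, a_i x ȳ)` WITH the forced signs AND `W₁ ⊕ W₂ ≅ W₃ ⊕ W₄`; its proof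
(`SignRecipe.exists_signsForced` :75, `SignRecipe.nonempty_faceSignDatum` :136) CHOOSES `a₀, a₁, a₂` by weak approximation and puts
`a₃ := a₀a₁a₂⁻¹`.  The per-pair reading of the O-side coupling (`CorCM/B01/FaceWedgeOverlapOfExhaustionMeeting.lean`, binder `hEP`,
p296878 ✔: «for every pair CARRYING A NON-ZERO THETA WEDGE — ONE isolation setting») consumes the SAME datum with `a₀, a₁` GIVEN —
the lines of the pair that exhaustion hands over.  This file proves that form by the tree's own argument with the choices replaced by
the data (manuscript locators: PerL v5 Def 3.2 `def:allowed` tex ll.269–279, Lemma 3.3 ll.280–298, choice of the lines ll.299–317;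
rfwf v3 §4.2 item (iv) tex ll.247–254; stage-1 declarations generalised: `HodgeCM/Proofs/RealisationConstruction.lean:122
exists_signsForced`, `:183 exists_seesawDatum`, pkg root `run/shared/lean/pub/pub-hodgecm/lean/HodgeCMPerL/`):

* `SignRecipe.exists_line_reqPos R Ψ` — an ALLOWED LINE of every type exists: `b ∈ F₀^×` with the required sign of `Ψ` at every
  complex embedding (weak approximation `NumberFields.exists_isReal_signs`; the required sign is a function of the place,
  `SignRecipe.reqPos_conjugate`).  In-kernel NON-VACUITY of the hypotheses `h₀ n₀ s₀ / h₁ n₁ s₁ / h₂ n₂ s₂` below.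
* `SignRecipe.signsForced_prescribed3` — for prescribed allowed `a₀, a₁, a₂` of types `Ψ 0, Ψ 1, Ψ 2` (pair-sum identity on `Ψ`),
  `a₃ := a₀a₁a₂⁻¹` is allowed of type `Ψ 3` (parity half of Lemma 3.3(b), `SignRecipe.reqPos_pairSum` .2) and `a₀a₁ = a₂a₃`.
* `SignRecipe.exists_faceSignDatum_prescribed3` — `∃ D : FaceSignDatum R Ψ` with `D.a = (a₀, a₁, a₂, a₀a₁a₂⁻¹)`: isometry by
  Landherr (`QuadraticForms.hermitianPlanes_isometric_of_invariants`; sign multisets by `reqPos_pairSum` .1, equal discriminants).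
* `SignRecipe.exists_faceSignDatum_prescribed` — THE PER-PAIR FORM: every allowed (12)-pair `a₀, a₁` extends to a sign/plane
  datum with `D.a 0 = a₀`, `D.a 1 = a₁` (third line by `exists_line_reqPos`).  In words: the plane `W_a ⊕ W_b` of ANY allowed
  (12)-pair admits the (34)-splitting of item (iv), with the first (34)-line free among the allowed ones — no parity ∕ Hasse
  obstruction (own-b01 (O-J) §6 clause 3, `HOME/b01/FACE-SUPPLY-EXISTS.md`; previously prose, IDEA-1r §C ∕ IDEA-2s (ii)).
* `exists_goodFaceCtx_prescribed` — face form (binder prefix of `FaceSignDatumExists` with the (12)-pair prescribed) together with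
  the good face context of items (v)/(vi) (`goodFaceCtx_of_faceSignDatum`).

QUANTIFIER AUDIT: as for item (iv) — NO `V`, NO level; `∀ R`, `∀ Ψ` with `PairSum Ψ`, `∀` allowed data.  What is NOT here (as in
the tree's item (iv)): the splitting characters (behind `Perl34.TorusData.allowed/X`, items (v)/(vi)), and the two Liu-side
identifications of the per-pair coupling — exhaustion-with-signs (E⁺) and placement — which stay print-located and un-typed.
-/

noncomputable section

open NumberField NumberField.InfinitePlace NumberField.ComplexEmbedding
open scoped Matrix

namespace Summit.HodgeConjecture.CorCM

namespace Transposition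

open Literature.AlgebraicGeometry.Motives (CMType)

/-- A conjugation-fixed non-zero element of a CM field is a non-zero REAL number at every complex embedding
(`Landherr.embedding_eq_re`). [folklore] -/
theorem exists_eq_ofReal_ne_zero_of_conj_eq {F : CMField} {b : F} (hb : IsCMField.complexConj F b = b) (hb0 : b ≠ 0)
    (τ : F →+* ℂ) : ∃ r : ℝ, τ b = r ∧ r ≠ 0 := by
  refine ⟨(τ b).re, Literature.NumberTheory.QuadraticForms.Landherr.embedding_eq_re hb τ, ?_⟩
  intro hr
  apply hb0
  have h : τ b = 0 := by
    rw [Literature.NumberTheory.QuadraticForms.Landherr.embedding_eq_re hb τ, hr]; simp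
  exact (map_eq_zero τ).mp h

namespace SignRecipe

variable {F : CMField} (R : SignRecipe F)

/-- **Allowed lines of every type exist** (PerL tex ll.299–304, the weak-approximation step of the stage-1
`ThetaModel.exists_signsForced`, `HodgeCM/Proofs/RealisationConstruction.lean:122`, isolated for ONE line): for every CM type `Ψ` and
every recipe there is `b ∈ F₀^×` — conjugation-fixed, non-zero — whose sign at every complex embedding is the required sign of the line
of type `Ψ` (`NumberFields.exists_isReal_signs` at the function of the PLACE given by `reqPos_conjugate`).  This is the in-kernel
non-vacuity of the «allowed line» hypotheses of the prescribed forms below. [folklore] -/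
theorem exists_line_reqPos (Ψ : CMType F) :
    ∃ b : F, IsCMField.complexConj F b = b ∧ b ≠ 0 ∧ ∀ τ : F →+* ℂ, (0 < (τ b).re ↔ R.reqPos Ψ τ = true) := by
  -- the required sign is a function of the place
  let P : InfinitePlace F → Bool := fun w => R.reqPos Ψ w.embedding
  have hP : ∀ τ : F →+* ℂ, R.reqPos Ψ τ = P (InfinitePlace.mk τ) := by
    intro τ
    have hτ : InfinitePlace.mk τ = InfinitePlace.mk (InfinitePlace.mk τ).embedding := by rw [mk_embedding]
    rcases mk_eq_iff.mp hτ with h | h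
    · simp only [P]; rw [← h]
    · simp only [P]; rw [← h, R.reqPos_conjugate]
  obtain ⟨τ₀⟩ := (inferInstance : Nonempty (F →+* ℂ))
  obtain ⟨b, hb, h⟩ := Literature.NumberTheory.NumberFields.exists_isReal_signs F P
  obtain ⟨r₁, hr₁, hr₁0, -⟩ := h τ₀
  refine ⟨b, hb, ne_zero_of_embedding τ₀ hr₁ hr₁0, fun τ => ?_⟩
  obtain ⟨r, hr, -, hiff⟩ := h τ
  rw [hr, Complex.ofReal_re, hP]
  exact hiff

/-- **Def 3.2 with the forced signs, THREE LINES PRESCRIBED** (PerL tex ll.299–314 read with `a₀, a₁, a₂` given; the parity step of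
the stage-1 `exists_signsForced`, `RealisationConstruction.lean:122`): if `a₀, a₁, a₂ ∈ F₀^×` carry the required signs of
`Ψ 0, Ψ 1, Ψ 2` at every complex embedding and `Ψ` has the pair-sum identity, then `a₃ := a₀a₁a₂⁻¹` carries the required sign of
`Ψ 3` (parity half of Lemma 3.3(b), `reqPos_pairSum` .2), `a₀a₁ = a₂a₃`, and the quadruple is a conjugation-fixed non-zero
sign-forced line system. [folklore] -/
theorem signsForced_prescribed3 (Ψ : Fin 4 → CMType F) (hΨ : PairSum Ψ) (a₀ a₁ a₂ : F)
    (h₀ : IsCMField.complexConj F a₀ = a₀) (h₁ : IsCMField.complexConj F a₁ = a₁) (h₂ : IsCMField.complexConj F a₂ = a₂)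
    (n₀ : a₀ ≠ 0) (n₁ : a₁ ≠ 0) (n₂ : a₂ ≠ 0)
    (s₀ : ∀ τ : F →+* ℂ, 0 < (τ a₀).re ↔ R.reqPos (Ψ 0) τ = true)
    (s₁ : ∀ τ : F →+* ℂ, 0 < (τ a₁).re ↔ R.reqPos (Ψ 1) τ = true)
    (s₂ : ∀ τ : F →+* ℂ, 0 < (τ a₂).re ↔ R.reqPos (Ψ 2) τ = true) :
    (∀ i, IsCMField.complexConj F (![a₀, a₁, a₂, a₀ * a₁ * a₂⁻¹] i) = ![a₀, a₁, a₂, a₀ * a₁ * a₂⁻¹] i) ∧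
      (∀ i, ![a₀, a₁, a₂, a₀ * a₁ * a₂⁻¹] i ≠ 0) ∧
      (a₀ * a₁ = a₂ * (a₀ * a₁ * a₂⁻¹)) ∧
      ∀ (i : Fin 4) (τ : F →+* ℂ), (0 < (τ (![a₀, a₁, a₂, a₀ * a₁ * a₂⁻¹] i)).re ↔ R.reqPos (Ψ i) τ = true) := by
  refine ⟨?_, ?_, ?_, ?_⟩
  · intro i
    fin_cases i
    · exact h₀
    · exact h₁
    · exact h₂
    · show IsCMField.complexConj F (a₀ * a₁ * a₂⁻¹) = a₀ * a₁ * a₂⁻¹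
      rw [map_mul, map_mul, map_inv₀, h₀, h₁, h₂]
  · intro i
    fin_cases i
    · exact n₀
    · exact n₁
    · exact n₂
    · show a₀ * a₁ * a₂⁻¹ ≠ 0
      exact mul_ne_zero (mul_ne_zero n₀ n₁) (inv_ne_zero n₂)
  · field_simp
  · intro i τ
    obtain ⟨r0, e0, hr0⟩ := exists_eq_ofReal_ne_zero_of_conj_eq h₀ n₀ τ
    obtain ⟨r1, e1, hr1⟩ := exists_eq_ofReal_ne_zero_of_conj_eq h₁ n₁ τ
    obtain ⟨r2, e2, hr2⟩ := exists_eq_ofReal_ne_zero_of_conj_eq h₂ n₂ τ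
    have i0 : 0 < r0 ↔ R.reqPos (Ψ 0) τ = true := by rw [← s₀ τ, e0, Complex.ofReal_re]
    have i1 : 0 < r1 ↔ R.reqPos (Ψ 1) τ = true := by rw [← s₁ τ, e1, Complex.ofReal_re]
    have i2 : 0 < r2 ↔ R.reqPos (Ψ 2) τ = true := by rw [← s₂ τ, e2, Complex.ofReal_re]
    fin_cases i
    · exact s₀ τ
    · exact s₁ τ
    · exact s₂ τ
    · show 0 < (τ (a₀ * a₁ * a₂⁻¹)).re ↔ R.reqPos (Ψ 3) τ = true
      have e3 : τ (a₀ * a₁ * a₂⁻¹) = ((r0 * r1 / r2 : ℝ) : ℂ) := by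
        rw [map_mul, map_mul, map_inv₀, e0, e1, e2]; push_cast; rw [div_eq_mul_inv]
      rw [e3, Complex.ofReal_re, pos_mul_div_iff hr0 hr1 hr2, i0, i1, i2]
      exact (R.reqPos_pairSum Ψ hΨ τ).2

/-- **Item (iv) PRESCRIBED, three lines** (PerL Def 3.2 + Lemma 3.3, tex ll.269–314, with `a₀, a₁, a₂` given; the Landherr step of the
stage-1 `ThetaModel.exists_seesawDatum`, `RealisationConstruction.lean:183`): for every quadruple of CM types with the pair-sum identity,
every sign recipe and every three allowed lines `a₀, a₁, a₂` of types `Ψ 0, Ψ 1, Ψ 2`, the sign/plane datum of item (iv) EXISTS WITH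
THESE LINES — `W₁ = (F, a₀xȳ)`, `W₂ = (F, a₁xȳ)`, `W₃ = (F, a₂xȳ)`, `W₄ = (F, a₀a₁a₂⁻¹xȳ)`, forced signs, and `W₁ ⊕ W₂ ≅ W₃ ⊕ W₄`
(`QuadraticForms.hermitianPlanes_isometric_of_invariants`: equal sign multisets at every embedding by `reqPos_pairSum` .1, equal
discriminants on the nose). [folklore] -/
theorem exists_faceSignDatum_prescribed3 (Ψ : Fin 4 → CMType F) (hΨ : PairSum Ψ) (a₀ a₁ a₂ : F)
    (h₀ : IsCMField.complexConj F a₀ = a₀) (h₁ : IsCMField.complexConj F a₁ = a₁) (h₂ : IsCMField.complexConj F a₂ = a₂)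
    (n₀ : a₀ ≠ 0) (n₁ : a₁ ≠ 0) (n₂ : a₂ ≠ 0)
    (s₀ : ∀ τ : F →+* ℂ, 0 < (τ a₀).re ↔ R.reqPos (Ψ 0) τ = true)
    (s₁ : ∀ τ : F →+* ℂ, 0 < (τ a₁).re ↔ R.reqPos (Ψ 1) τ = true)
    (s₂ : ∀ τ : F →+* ℂ, 0 < (τ a₂).re ↔ R.reqPos (Ψ 2) τ = true) :
    ∃ D : FaceSignDatum R Ψ, D.a 0 = a₀ ∧ D.a 1 = a₁ ∧ D.a 2 = a₂ ∧ D.a 3 = a₀ * a₁ * a₂⁻¹ := by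
  obtain ⟨ha, hne, hdisc, hsign⟩ := R.signsForced_prescribed3 Ψ hΨ a₀ a₁ a₂ h₀ h₁ h₂ n₀ n₁ n₂ s₀ s₁ s₂
  set a : Fin 4 → F := ![a₀, a₁, a₂, a₀ * a₁ * a₂⁻¹] with ha_def
  have hmult : ∀ τ : F →+* ℂ,
      ({decide (0 < (τ (a 0)).re), decide (0 < (τ (a 1)).re)} : Multiset Bool) =
        {decide (0 < (τ (a 2)).re), decide (0 < (τ (a 3)).re)} := by
    intro τ
    rw [decide_eq_of_iff' (hsign 0 τ), decide_eq_of_iff' (hsign 1 τ), decide_eq_of_iff' (hsign 2 τ),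
      decide_eq_of_iff' (hsign 3 τ)]
    exact (R.reqPos_pairSum Ψ hΨ τ).1
  have hdisc' : a 0 * a 1 = a 2 * a 3 := hdisc
  obtain ⟨g, hg⟩ := Literature.NumberTheory.QuadraticForms.hermitianPlanes_isometric_of_invariants F a ha hne hmult
    ⟨1, one_ne_zero, by rw [map_one, mul_one, mul_one, hdisc']⟩
  exact ⟨{ a := a, a_real := ha, a_ne := hne, iso := ⟨g, hg⟩, forced := hsign }, rfl, rfl, rfl, rfl⟩

/-- **Item (iv) PRESCRIBED, two lines — THE PER-PAIR FORM** (the plane/sign half of «one isolation setting per wedge-carrying pair»,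
`CorCM/B01/FaceWedgeOverlapOfExhaustionMeeting.lean` binder `hEP`): for every allowed (12)-pair `a₀, a₁` (conjugation-fixed,
non-zero, required signs of `Ψ 0, Ψ 1`) there is a sign/plane datum of item (iv) whose first two lines ARE `a₀, a₁`; the third line is
an allowed line of type `Ψ 2` from `exists_line_reqPos`, exactly as in the tree's `exists_signsForced`.  In words: the plane
`W_a ⊕ W_b` of ANY allowed (12)-pair admits the (34)-splitting of item (iv). [folklore] -/
theorem exists_faceSignDatum_prescribed (Ψ : Fin 4 → CMType F) (hΨ : PairSum Ψ) (a₀ a₁ : F)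
    (h₀ : IsCMField.complexConj F a₀ = a₀) (h₁ : IsCMField.complexConj F a₁ = a₁) (n₀ : a₀ ≠ 0) (n₁ : a₁ ≠ 0)
    (s₀ : ∀ τ : F →+* ℂ, 0 < (τ a₀).re ↔ R.reqPos (Ψ 0) τ = true)
    (s₁ : ∀ τ : F →+* ℂ, 0 < (τ a₁).re ↔ R.reqPos (Ψ 1) τ = true) :
    ∃ D : FaceSignDatum R Ψ, D.a 0 = a₀ ∧ D.a 1 = a₁ := by
  obtain ⟨b, hb, hbne, s₂⟩ := R.exists_line_reqPos (Ψ 2)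
  obtain ⟨D, hD0, hD1, -, -⟩ := R.exists_faceSignDatum_prescribed3 Ψ hΨ a₀ a₁ b h₀ h₁ hb n₀ n₁ hbne s₀ s₁ s₂
  exact ⟨D, hD0, hD1⟩

/-- **Every allowed line lies in a sign/plane datum** (one line prescribed): an allowed line `a₀` of type `Ψ 0` is the first line
of some `D : FaceSignDatum R Ψ` (second line from `exists_line_reqPos`, then the per-pair form). [folklore] -/
theorem exists_faceSignDatum_prescribed1 (Ψ : Fin 4 → CMType F) (hΨ : PairSum Ψ) (a₀ : F)
    (h₀ : IsCMField.complexConj F a₀ = a₀) (n₀ : a₀ ≠ 0) (s₀ : ∀ τ : F →+* ℂ, 0 < (τ a₀).re ↔ R.reqPos (Ψ 0) τ = true) :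
    ∃ D : FaceSignDatum R Ψ, D.a 0 = a₀ := by
  obtain ⟨b, hb, hbne, s₁⟩ := R.exists_line_reqPos (Ψ 1)
  obtain ⟨D, hD0, -⟩ := R.exists_faceSignDatum_prescribed Ψ hΨ a₀ b h₀ hb n₀ hbne s₀ s₁
  exact ⟨D, hD0⟩

end SignRecipe

/-- **Face form with the (12)-pair prescribed** (the binder prefix of `FaceSignDatumExists`, `Item4SignsPlane.lean`:374): at every
Galois CM field of degree `≥ 6`, every rank-four face `f`, every admissible `ι₁` and every recipe, an allowed (12)-pair `a₀, a₁` for the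
period types `f.psi 0, f.psi 1` extends to a sign/plane datum `D` for `f.psi` with `D.a 0 = a₀`, `D.a 1 = a₁`, AND the good face
context of items (v)/(vi) holds at `D` (`goodFaceCtx_of_faceSignDatum`: `pairSum_psi`, `StubTree.psi_injective`, `admissible_mem_psi`).
The Galois ∕ degree binders are idle (kept to match the face prefix; cf. stage-1 `realisationExistsFace_of`,
`RealisationConstruction.lean:355`). [folklore] -/
theorem exists_goodFaceCtx_prescribed (F : CMField) (_hG : IsGalois ℚ F) (_h6 : 6 ≤ Module.finrank ℚ F) (f : Face F)
    (ι₁ : F →+* ℂ) (hι : f.Admissible ι₁) (R : SignRecipe F) (a₀ a₁ : F)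
    (h₀ : IsCMField.complexConj F a₀ = a₀) (h₁ : IsCMField.complexConj F a₁ = a₁) (n₀ : a₀ ≠ 0) (n₁ : a₁ ≠ 0)
    (s₀ : ∀ τ : F →+* ℂ, 0 < (τ a₀).re ↔ R.reqPos (f.psi 0) τ = true)
    (s₁ : ∀ τ : F →+* ℂ, 0 < (τ a₁).re ↔ R.reqPos (f.psi 1) τ = true) :
    ∃ D : FaceSignDatum R f.psi, D.a 0 = a₀ ∧ D.a 1 = a₁ ∧ GoodFaceCtx R f.psi ι₁ D.toSeesawDatum := by
  obtain ⟨D, hD0, hD1⟩ := R.exists_faceSignDatum_prescribed f.psi (pairSum_psi f) a₀ a₁ h₀ h₁ n₀ n₁ s₀ s₁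
  exact ⟨D, hD0, hD1, goodFaceCtx_of_faceSignDatum R f ι₁ hι D⟩

end Transposition

end Summit.HodgeConjecture.CorCM

end
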